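import Summits.BirchSwinnertonDyer.BirchSwinnertonDyer.Theorems.GenusKolyvaginAtTwoGenusPrimitiveSupplyAtTwoTwistingPrimeDepthEntangledLocal
import HarnessLib

/-!
# Route `GenusKolyvaginAtTwo`, crux #2 `GenusPrimitiveSupplyAtTwo` (stmt-BirchSwinnertonDyer-22136):
# ENTANGLED ⟺ STRICT AT EVERY DEPTH-`M` KOLYVAGIN PRIME — the inflation kernel `Inf H¹(Gal(ℚ(E[2^M])/ℚ), E[2])`
# is detected exactly by the Kolyvagin primes of depth `M`

Width seat `bsd-line-gk2-p4` g9 (cell `bsd-f1-sign2`), seventeenth file of the twisting-prime series (crux workfile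
`Lines/genus-supply-depth-class.md` §4). THEOREMS ONLY (no definition, no named fact, no `sorry`); helper
`--supports stmt-BirchSwinnertonDyer-22136`; no item is closed; BSD is not proved by any of this.

The two halves of the local criterion at `2` for a class of a twist, now an `iff`:
* g8's Čebotarev supply (`exists_kolyvaginPrime_pow_not_mem_torsionLocalKer_twin`, F2): a class `x ∈ H¹(ℚ, Wd[2])` that does NOT die on
  `Γ_{ℚ(E[2^M])}` is NON-strict at infinitely many depth-`M` Kolyvagin primes (beyond every finite `B₀`, in every class `m ∣ ℓ + 1`);
* g9's converse (`mem_torsionLocalKer_of_forall_torsionFixing_pow_h1Eval_eq_zero`, p626618 §32): a class that DIES on `Γ_{ℚ(E[2^M])}` is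
  STRICT at EVERY depth-`M` Kolyvagin prime `ℓ ∤ 2N_W`.
Hence (`forall_torsionFixing_pow_h1Eval_eq_zero_iff_forall_frobEqFrobInfty_mem_torsionLocalKer`): for `W/ℚ` elliptic with `Δ_W < 0`
and `ρ̄_{W,2}` onto, `K` imaginary quadratic, `M ≥ 1`, `Wd` any elliptic model of a twist `W^{(d)}` (`d ≠ 0`; `d = 1` gives `W` itself) and
`x ∈ H¹(ℚ, Wd[2])`:

  `x` dies on `Γ_{ℚ(E[2^M])}` (is inflated from `Gal(ℚ(E[2^M])/ℚ)`)
  ⟺ `x_ℓ = 0` at EVERY odd prime `ℓ ∤ N_W` with `Frob_ℓ = Frob_∞` on `K(E[2^M])`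
  ⟺ `x_ℓ = 0` at all but finitely many such primes (`…_iff_exists_finset_…`).

Reading for the cell (-es MEMO §13, DES13's 2/510): a row-1 twin `A = E^{(d_K)}` is ENTANGLED (`κ(P_A) = ξ_E|_A`, the Lawson–Wuthrich
class) iff its Selmer class is strict at every depth-`2` Kolyvagin prime iff it is strict at a cofinite set of them — a Čebotarev-density
statement about ONE rational point, decidable prime by prime (`P_A ∈ 2A(ℚ_ℓ)`), and the exact obstruction to the depth-`2` supply.

References: [GrossLMS1991] §9 Prop. 9.6; [McCallumLMS1991] §3 (3); [MazurRubin2010] Def. 3.1, Lemma 3.5; [LawsonWuthrich2016] Lemma 6, Thm. 1.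
-/

set_option linter.dupNamespace false -- tree convention: `Summit.BirchSwinnertonDyer.BirchSwinnertonDyer.Theorems` (summit = sub-problem)
set_option autoImplicit false

noncomputable section

open scoped Classical Pointwise

namespace Summit.BirchSwinnertonDyer.BirchSwinnertonDyer.Theorems.GenusKolyTwistingPrime

open WeierstrassCurve NumberField IsDedekindDomain Field
open Literature.NumberTheory.GaloisRepresentations Literature.NumberTheory.EllipticCurves
open Literature.NumberTheory

section Iff

variable (W : WeierstrassCurve ℚ) [W.IsElliptic] {K : Type} [Field K] [NumberField K]

omit [W.IsElliptic] in
/-- The discriminant of a model of a quadratic twist has the sign of `Δ_W`. [cite: SilvermanAEC2009, X.5 Cor. 5.4] -/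
theorem Δ_neg_of_smul_quadraticTwist' {d : ℚ} (hd : d ≠ 0) (hΔ : W.Δ < 0) {Wd : WeierstrassCurve ℚ}
    {C : VariableChange ℚ} (hC : C • W.quadraticTwist d = Wd) : Wd.Δ < 0 := by
  rw [← hC, variableChange_Δ, quadraticTwist_Δ]
  have hu : (0 : ℚ) < ((C.u⁻¹ : ℚˣ) : ℚ) ^ 12 := Even.pow_pos (by decide) (Units.ne_zero _)
  have hd6 : (0 : ℚ) < d ^ 6 := Even.pow_pos (by decide) hd
  nlinarith [mul_pos hu hd6]

/-- **A class of a twist NOT dying on `Γ_{ℚ(E[2^M])}` is NON-strict at a depth-`M` Kolyvagin prime beyond every bound** (single-class form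
of g8's `exists_kolyvaginPrime_pow_not_mem_torsionLocalKer_twin`: the auxiliary `W`-class is the transport of `x` along `Wd[2] ≅ W[2]`).
[cite: MazurRubin2010, Lemma 3.5, Prop. 3.3] [cite: GrossLMS1991, §3 (3.1)–(3.3), §9 Prop. 9.6] -/
theorem exists_kolyvaginPrime_pow_not_mem_torsionLocalKer_of_exists_h1Eval_ne
    (hsurj : W.HasSurjectiveModNGaloisRep 2) (hΔ : W.Δ < 0) (hK : IsImaginaryQuadratic K) {M : ℕ} (hM : 1 ≤ M)
    {d : ℚ} (hd : d ≠ 0) {Wd : WeierstrassCurve ℚ} [Wd.IsElliptic] {C : VariableChange ℚ} (hWd : C • W.quadraticTwist d = Wd)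
    {x : galH1Torsion Wd (2 : ℤ)} (hx : ∃ h ∈ torsionFixing W ((2 ^ M : ℕ) : ℤ), h1Eval Wd (2 : ℤ) x h ≠ 0)
    {m : ℕ} (hm : m ≠ 0) (B₀ : Finset ℕ) :
    ∃ ℓ : ℕ, ∃ _ : Fact ℓ.Prime, ℓ ∉ B₀ ∧ m ∣ ℓ + 1 ∧ IsKolyvaginPrime (W.conductorNorm ℤ) W K 2 ℓ ∧
      FrobEqFrobInfty W K (2 ^ M) ℓ ∧ x ∉ Wd.torsionLocalKer ℚ_[ℓ] (2 : ℤ) := by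
  haveI : NeZero (W.conductorNorm ℤ) := ⟨(W.conductorNorm_pos_holds).ne'⟩
  -- transport `x` to a class of `W` with the same evaluations on `Γ_{ℚ(E[2^M])}`
  obtain ⟨ψ, hψ⟩ := exists_equivariant_addEquiv_geomTorsion_two_of_twist W hd hWd
  obtain ⟨Ψ, -, hΨeval, -⟩ := exists_h1Map_of_equivariant_addEquiv Wd W (2 : ℤ) ψ hψ
  have h2M : (2 : ℤ) ∣ ((2 ^ M : ℕ) : ℤ) := by
    rw [Nat.cast_pow, Nat.cast_ofNat]; exact dvd_pow_self 2 (by omega : M ≠ 0)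
  have hTM : torsionFixing W ((2 ^ M : ℕ) : ℤ) ≤ torsionFixing W (2 : ℤ) :=
    KolyvaginLowerBoundAtTwo.torsionFixing_le_of_dvd W h2M
  have hTd : torsionFixing W (2 : ℤ) ≤ torsionFixing Wd (2 : ℤ) :=
    torsionFixing_le_of_equivariant_addEquiv Wd W (2 : ℤ) ψ hψ
  have hc : ∃ h ∈ torsionFixing W ((2 ^ M : ℕ) : ℤ), h1Eval W (2 : ℤ) (Ψ x) h ≠ 0 := by
    obtain ⟨h, hT, hh⟩ := hx
    refine ⟨h, hT, ?_⟩
    rw [hΨeval x (hTM hT) (hTd (hTM hT))]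
    exact fun h0 ↦ hh (ψ.injective (h0.trans (map_zero ψ).symm))
  obtain ⟨ℓ, hℓF, hℓB₀, hmdvd, hKoly, hFrobM, -, hxℓ⟩ :=
    exists_kolyvaginPrime_pow_not_mem_torsionLocalKer_twin W hsurj hΔ hK hM hd hWd hc hx hm
      (W.conductorNorm ℤ) B₀
  exact ⟨ℓ, hℓF, hℓB₀, hmdvd, hKoly, hFrobM, hxℓ⟩

/-- **ENTANGLED ⟺ STRICT AT EVERY DEPTH-`M` KOLYVAGIN PRIME.** `W/ℚ` globally minimal elliptic with `Δ_W < 0` and `ρ̄_{W,2}` onto, `K` imaginary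
quadratic, `M ≥ 1`, `Wd` any elliptic model of `W^{(d)}` (`d ≠ 0`), `x ∈ H¹(ℚ, Wd[2])`. Then `x` DIES on `Γ_{ℚ(E[2^M])}` (`[x, h] = 0` for
every `h` fixing `E[2^M]`, i.e. `x ∈ Inf H¹(Gal(ℚ(E[2^M])/ℚ), Wd[2])`) IFF `x_ℓ = 0` in `H¹(ℚ_ℓ, Wd[2])` at EVERY odd prime `ℓ ∤ N_W` with
`FrobEqFrobInfty W K (2^M) ℓ` (the depth-`M` Kolyvagin primes of the frame). (⟹: p626618 §32, the local criterion for an inflated class;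
⟸: Čebotarev, the single-class supply above with `B₀ = ∅`.) The inflation kernel is DETECTED EXACTLY by the depth-`M` Kolyvagin primes.
[cite: GrossLMS1991, §9 Prop. 9.6] [cite: MazurRubin2010, Def. 3.1, Lemma 3.5] [cite: LawsonWuthrich2016, Lemma 6 and Thm. 1] -/
theorem forall_torsionFixing_pow_h1Eval_eq_zero_iff_forall_frobEqFrobInfty_mem_torsionLocalKer
    (hsurj : W.HasSurjectiveModNGaloisRep 2) (hΔ : W.Δ < 0) (hK : IsImaginaryQuadratic K) {M : ℕ} (hM : 1 ≤ M)
    {d : ℚ} (hd : d ≠ 0) {Wd : WeierstrassCurve ℚ} [Wd.IsElliptic] {C : VariableChange ℚ} (hWd : C • W.quadraticTwist d = Wd)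
    (x : galH1Torsion Wd (2 : ℤ)) :
    (∀ h ∈ torsionFixing W ((2 ^ M : ℕ) : ℤ), h1Eval Wd (2 : ℤ) x h = 0) ↔
      ∀ (ℓ : ℕ) (_ : Fact ℓ.Prime), ℓ ≠ 2 → ¬ ℓ ∣ W.conductorNorm ℤ → FrobEqFrobInfty W K (2 ^ M) ℓ →
        x ∈ Wd.torsionLocalKer ℚ_[ℓ] (2 : ℤ) := by
  have hΔd : Wd.Δ < 0 := Δ_neg_of_smul_quadraticTwist' W hd hΔ hWd
  constructor
  · intro hx ℓ _ hℓ2 hℓN hFrob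
    exact mem_torsionLocalKer_of_forall_torsionFixing_pow_h1Eval_eq_zero W hd hWd hΔd hM hℓ2 hℓN hFrob hx
  · intro hstrict
    by_contra hx
    push Not at hx
    obtain ⟨ℓ, hℓF, -, -, hKoly, hFrobM, hxℓ⟩ :=
      exists_kolyvaginPrime_pow_not_mem_torsionLocalKer_of_exists_h1Eval_ne W hsurj hΔ hK hM hd hWd hx one_ne_zero ∅
    exact hxℓ (hstrict ℓ hℓF hKoly.2.2.2.1 hKoly.2.1 hFrobM)

/-- **… IFF strict at a COFINITE set of depth-`M` Kolyvagin primes**: it suffices that `x_ℓ = 0` at every depth-`M` Kolyvagin prime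
outside some finite set `B₀` (Čebotarev supplies non-strict primes beyond every bound when `x` is not inflated). So the dichotomy is sharp:
an inflated class is strict at ALL depth-`M` Kolyvagin primes, a non-inflated one is non-strict at INFINITELY many.
[cite: GrossLMS1991, §9 Prop. 9.6] [cite: MazurRubin2010, Lemma 3.5] -/
theorem forall_torsionFixing_pow_h1Eval_eq_zero_iff_exists_finset_forall_frobEqFrobInfty_mem_torsionLocalKer
    (hsurj : W.HasSurjectiveModNGaloisRep 2) (hΔ : W.Δ < 0) (hK : IsImaginaryQuadratic K) {M : ℕ} (hM : 1 ≤ M)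
    {d : ℚ} (hd : d ≠ 0) {Wd : WeierstrassCurve ℚ} [Wd.IsElliptic] {C : VariableChange ℚ} (hWd : C • W.quadraticTwist d = Wd)
    (x : galH1Torsion Wd (2 : ℤ)) :
    (∀ h ∈ torsionFixing W ((2 ^ M : ℕ) : ℤ), h1Eval Wd (2 : ℤ) x h = 0) ↔
      ∃ B₀ : Finset ℕ, ∀ (ℓ : ℕ) (_ : Fact ℓ.Prime), ℓ ∉ B₀ → IsKolyvaginPrime (W.conductorNorm ℤ) W K 2 ℓ →
        FrobEqFrobInfty W K (2 ^ M) ℓ → x ∈ Wd.torsionLocalKer ℚ_[ℓ] (2 : ℤ) := by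
  constructor
  · intro hx
    refine ⟨∅, fun ℓ _ _ hKoly hFrob ↦ ?_⟩
    exact (forall_torsionFixing_pow_h1Eval_eq_zero_iff_forall_frobEqFrobInfty_mem_torsionLocalKer W hsurj hΔ hK hM hd hWd
      x).mp hx ℓ inferInstance hKoly.2.2.2.1 hKoly.2.1 hFrob
  · rintro ⟨B₀, hB₀⟩
    by_contra hx
    push Not at hx
    obtain ⟨ℓ, hℓF, hℓB₀, -, hKoly, hFrobM, hxℓ⟩ :=
      exists_kolyvaginPrime_pow_not_mem_torsionLocalKer_of_exists_h1Eval_ne W hsurj hΔ hK hM hd hWd hx one_ne_zero B₀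
    exact hxℓ (hB₀ ℓ hℓF hℓB₀ hKoly hFrobM)

/-- **Selmer-level form: the twin hypothesis of the depth-`M` supply is EQUIVALENT to non-strictness at some (equivalently: at infinitely
many) depth-`M` Kolyvagin prime.** For the twin `Wd`: «some Selmer class of `Wd` does not die on `Γ_{ℚ(E[2^M])}`» (hypothesis `hS'` of
g8's `exists_kolyvaginPrime_pow_genusPair_selmer_of_cor34i`) ⟺ «`Sel₂(Wd)` is NOT strict at some odd prime `ℓ ∤ N_W` with
`FrobEqFrobInfty W K (2^M) ℓ`». [cite: MazurRubin2010, Def. 3.1, Prop. 3.3, Lemma 3.5] [cite: GrossLMS1991, §9 Prop. 9.6] -/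
theorem exists_selmer_h1Eval_ne_iff_exists_frobEqFrobInfty_not_le_strictLocalKer
    (hsurj : W.HasSurjectiveModNGaloisRep 2) (hΔ : W.Δ < 0) (hK : IsImaginaryQuadratic K) {M : ℕ} (hM : 1 ≤ M)
    {d : ℚ} (hd : d ≠ 0) {Wd : WeierstrassCurve ℚ} [Wd.IsElliptic] {C : VariableChange ℚ} (hWd : C • W.quadraticTwist d = Wd) :
    (∃ c ∈ Wd.selmerGroup 2, ∃ h ∈ torsionFixing W ((2 ^ M : ℕ) : ℤ), h1Eval Wd (2 : ℤ) c h ≠ 0) ↔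
      ∃ (ℓ : ℕ) (_ : Fact ℓ.Prime), ℓ ≠ 2 ∧ ¬ ℓ ∣ W.conductorNorm ℤ ∧ FrobEqFrobInfty W K (2 ^ M) ℓ ∧
        ¬ Wd.selmerGroup 2 ≤ MazurRubin2010.strictLocalKer Wd ℚ_[ℓ] 2 := by
  have hΔd : Wd.Δ < 0 := Δ_neg_of_smul_quadraticTwist' W hd hΔ hWd
  constructor
  · rintro ⟨c, hcS, hc⟩
    obtain ⟨ℓ, hℓF, -, -, hKoly, hFrobM, hcℓ⟩ :=
      exists_kolyvaginPrime_pow_not_mem_torsionLocalKer_of_exists_h1Eval_ne W hsurj hΔ hK hM hd hWd hc one_ne_zero ∅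
    exact ⟨ℓ, hℓF, hKoly.2.2.2.1, hKoly.2.1, hFrobM, fun hle ↦ hcℓ (hle hcS)⟩
  · rintro ⟨ℓ, hℓF, hℓ2, hℓN, hFrob, hns⟩
    by_contra hall
    push Not at hall
    exact hns (selmerGroup_le_strictLocalKer_of_forall_torsionFixing_pow_h1Eval_eq_zero W hd hWd hΔd hM hℓ2 hℓN hFrob hall)

end Iff

end Summit.BirchSwinnertonDyer.BirchSwinnertonDyer.Theorems.GenusKolyTwistingPrime

end
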